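import Summits.QuantumFields.QCD.Theorems.HeatSlicedQuarksQuarkLoopCoefficientWindowBound
import Summits.QuantumFields.QCD.Theorems.HeatSlicedQuarksQuarkLoopCoefficientFreeMajorantToolkit
import Summits.QuantumFields.QCD.Theorems.HeatSlicedQuarksQuarkLoopCoefficientFreeHeatCalculus
import Summits.QuantumFields.QCD.Theorems.HeatSlicedQuarksQuarkLoopCoefficientTorusToPlane
import Summits.QuantumFields.QCD.Theorems.HeatSlicedQuarksQuarkLoopCoefficientGaussianMajorant
import Summits.QuantumFields.QCD.Theorems.HeatSlicedQuarksQuarkLoopCoefficientSecondOrderExpansion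
import Summits.QuantumFields.QCD.Theorems.HeatSlicedQuarksQuarkLoopCoefficientSecondOrderCoefficient

/-!
# The quark-loop coefficient (crux stmt-QuantumFields-16786, line `Sketch`): composition, part A

Helper file of the composition of the line `Sketch` (see `…HeatSlicedQuarksQuarkLoopCoefficient.lean` for the crux and
the overview): the three analytic inputs of the core regime obtained from the landed stubs
(`gaussianMajorant_holds`, `secondOrderExpansion_holds`, `secondOrderCoefficient_holds`, stated expanded), the
verification that the free configuration `U ≡ 1` satisfies the crux hypotheses with `θ = 0`, elementary facts on the
colour charges and `|θ²/2 − (1 − cos θ)| ≤ 5θ⁴/96`, and the abstract image-tail lemma for twisted periodizations.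
-/

noncomputable section

namespace Summit.QuantumFields.QCD.Cruxes.QuarkLoopCoefficient.Sketch

open Literature.MathematicalPhysics.QuantumLattice Literature.MathematicalPhysics.QuantumFieldTheory
open Literature.Probability.LatticeModels (Site TorusSite)
open Summit.QuantumFields.QCD.Theses.HeatSlicedQuarks
open Summit.QuantumFields.QCD.Theorems.QuarkLoopCoefficient
open Summit.QuantumFields.QCD.Cruxes.QuarkLoopCoefficient.Sketch.FreeMajorantToolkit (gaussProfile_nonneg)
open scoped Matrix ComplexConjugate

/-! ### Composition -/

/-- The Gaussian majorant from the landed stubs (`GaussianMajorant`, expanded). -/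
theorem gaussianMajorant_holds :
    (∃ c₀ : ℝ, 0 < c₀ ∧ ∃ C c : ℝ, 0 < c ∧ ∀ θ t : ℝ, 0 ≤ t → |θ| ≤ c₀ → |θ| * t ≤ c₀ →
        ∀ (w : Site 4) (α β : Fin 4), ‖symHeat θ t w α β‖ ≤ C * gaussProfile c t w) :=
  stub_gaussianMajorant stub_freeMajorantToolkit (FreeHeatCalculus.stub_freeHeatCalculus stub_freeMajorantToolkit)

/-- The second-order expansion from the landed stubs (`SecondOrderExpansion`, expanded). -/
theorem secondOrderExpansion_holds :
    (∃ c₀ : ℝ, 0 < c₀ ∧ ∃ C : ℝ, ∃ a₁ a₃ : ℝ → ℂ, ∀ θ t : ℝ, 1 ≤ t → |θ| * t ≤ c₀ →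
        ‖(∑ α : Fin 4, (symHeat θ t 0 α α - symHeat 0 t 0 α α)) -
            ((θ : ℂ) * a₁ t + (θ : ℂ) ^ 2 * e2 t + (θ : ℂ) ^ 3 * a₃ t)‖ ≤ C * θ ^ 4 * t ^ 2) :=
  stub_secondOrderExpansion stub_freeMajorantToolkit (FreeHeatCalculus.stub_freeHeatCalculus stub_freeMajorantToolkit)
    gaussianMajorant_holds

/-- The second-order coefficient asymptotics from the landed stubs (`SecondOrderCoefficient`, expanded). -/
theorem secondOrderCoefficient_holds :
    (∃ C : ℝ, ∀ t : ℝ, 1 ≤ t → ‖e2 t - ((1 / (12 * Real.pi ^ 2) : ℝ) : ℂ)‖ ≤ C / t) :=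
  stub_secondOrderCoefficient stub_freeMajorantToolkit (FreeHeatCalculus.stub_freeHeatCalculus stub_freeMajorantToolkit)

/-! #### §2.1 The free configuration satisfies the crux hypotheses with `θ = 0` -/

/-- Off-diagonal entries of the free links vanish. -/
theorem free_offdiag (L : ℕ) :
    ∀ (e : Edge 4 L) (i j : Fin 3), i ≠ j →
      (fundamentalRep (Fin 3)) ((fun _ : Edge 4 L => (1 : Matrix.specialUnitaryGroup (Fin 3) ℂ)) e) i j = 0 := by
  intro e i j hij
  simp [Matrix.one_apply_ne hij]

/-- The `(0,1)` plaquettes of the free configuration are `diag(e^{i0}, e^{−i0}, 1)`. -/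
theorem free_flux (L : ℕ) :
    ∀ y : TorusSite 4 L, (fundamentalRep (Fin 3))
        (plaquetteHolonomy (fun _ : Edge 4 L => (1 : Matrix.specialUnitaryGroup (Fin 3) ℂ)) y 0 1) =
      Matrix.diagonal ![Complex.exp (Complex.I * (0 : ℝ)), Complex.exp (-(Complex.I * (0 : ℝ))), 1] := by
  intro y
  have h1 : plaquetteHolonomy (fun _ : Edge 4 L => (1 : Matrix.specialUnitaryGroup (Fin 3) ℂ)) y 0 1 = 1 := by
    simp [plaquetteHolonomy]
  rw [h1, map_one]
  ext i j
  fin_cases i <;> fin_cases j <;> simp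

/-- All plaquettes of the free configuration are trivial. -/
theorem free_flat (L : ℕ) :
    ∀ (y : TorusSite 4 L) (μ ν : Fin 4), ¬(μ = 0 ∧ ν = 1) → ¬(μ = 1 ∧ ν = 0) →
      plaquetteHolonomy (fun _ : Edge 4 L => (1 : Matrix.specialUnitaryGroup (Fin 3) ℂ)) y μ ν = 1 := by
  intro y μ ν _ _
  simp [plaquetteHolonomy]

/-! #### §2.2 Elementary facts -/

/-- `charge a 0 = 0`. -/
theorem charge_zero (a : Fin 3) : charge a 0 = 0 := by
  simp [charge]

/-- `|charge a θ| ≤ |θ|`. -/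
theorem abs_charge_le (a : Fin 3) (θ : ℝ) : |charge a θ| ≤ |θ| := by
  unfold charge
  split_ifs <;> simp

/-- The colour sum of a function of the charge: `f θ + f (−θ) + f 0`. -/
theorem sum_charge (f : ℝ → ℝ) (θ : ℝ) : ∑ a : Fin 3, f (charge a θ) = f θ + f (-θ) + f 0 := by
  simp [charge, Fin.sum_univ_three]

/-- The deck vector of `0` is `0`. -/
theorem deck_zero (L : ℕ) : (fun μ : Fin 4 => (L : ℤ) * (0 : Site 4) μ) = 0 := by
  funext μ; simp

/-- The cosine remainder: `|θ²/2 − (1 − cos θ)| ≤ (5/96) θ⁴` for `|θ| ≤ 1`. -/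
theorem cos_main_term {θ : ℝ} (hθ : |θ| ≤ 1) :
    |θ ^ 2 / (6 * Real.pi ^ 2) - (1 - Real.cos θ) / (3 * Real.pi ^ 2)| ≤ 5 / 96 * θ ^ 4 := by
  have hb := Real.cos_bound hθ
  have hpi : 1 ≤ 3 * Real.pi ^ 2 := by nlinarith [Real.pi_gt_three]
  have key : θ ^ 2 / (6 * Real.pi ^ 2) - (1 - Real.cos θ) / (3 * Real.pi ^ 2) =
      (Real.cos θ - (1 - θ ^ 2 / 2)) / (3 * Real.pi ^ 2) := by
    field_simp
    ring
  rw [key, abs_div, abs_of_pos (by positivity : (0:ℝ) < 3 * Real.pi ^ 2)]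
  calc |Real.cos θ - (1 - θ ^ 2 / 2)| / (3 * Real.pi ^ 2)
      ≤ |Real.cos θ - (1 - θ ^ 2 / 2)| / 1 :=
        div_le_div_of_nonneg_left (abs_nonneg _) one_pos hpi
    _ ≤ |θ| ^ 4 * (5 / 96) := by rw [div_one]; exact hb
    _ = 5 / 96 * θ ^ 4 := by rw [pow_abs, abs_of_nonneg (by positivity : (0:ℝ) ≤ θ ^ 4)]; ring

/-! #### §2.3 Images: the tail of the twisted periodization -/

/-- From a `HasSum` representation and a nonnegative summable majorant of the summands off the origin, the value
differs from the `n = 0` term by at most the majorant's image sum. -/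
theorem image_tail {F : Site 4 → ℂ} {S : ℂ} (hF : HasSum F S) {g : Site 4 → ℝ}
    (hg : Summable g) (hg0 : ∀ n, 0 ≤ g n) (hle : ∀ n, n ≠ 0 → ‖F n‖ ≤ g n) :
    ‖S - F 0‖ ≤ ∑' n : Site 4, (if n = 0 then 0 else g n) := by
  classical
  have hsum : Summable F := hF.summable
  have hsplit : ∑' n, F n = F 0 + ∑' n, (if n = 0 then 0 else F n) := hsum.tsum_eq_add_tsum_ite 0
  have hS : S - F 0 = ∑' n, (if n = 0 then 0 else F n) := by
    rw [← hF.tsum_eq, hsplit]; ring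
  have hpt : ∀ n, ‖(if n = 0 then 0 else F n)‖ ≤ (if n = 0 then 0 else g n) := by
    intro n
    split_ifs with h
    · simp
    · exact hle n h
  have hg' : Summable (fun n : Site 4 => if n = 0 then 0 else g n) := by
    refine Summable.of_nonneg_of_le (fun n => ?_) (fun n => ?_) hg
    · split_ifs
      · exact le_rfl
      · exact hg0 n
    · split_ifs
      · exact hg0 n
      · exact le_rfl
  have hnorm : Summable (fun n : Site 4 => ‖(if n = 0 then 0 else F n)‖) :=
    Summable.of_nonneg_of_le (fun n => norm_nonneg _) hpt hg'
  rw [hS]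
  exact (norm_tsum_le_tsum_norm hnorm).trans (hnorm.tsum_le_tsum hpt hg')

/-! ## Registered headline -/

/-- Registered headline of this helper file (aux stub `stub_quarkLoopAssemblyAux` of crux stmt-QuantumFields-16786,
line `Sketch`): the cosine main term, `|θ²/(6π²) − (1 − cos θ)/(3π²)| ≤ (5/96) θ⁴` for `|θ| ≤ 1`. -/
theorem stub_quarkLoopAssemblyAux : ∀ (θ : ℝ), |θ| ≤ 1 → |θ ^ 2 / (6 * Real.pi ^ 2) - (1 - Real.cos θ) / (3 * Real.pi ^ 2)| ≤ 5 / 96 * θ ^ 4 :=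
  fun _ hθ => cos_main_term hθ

end Summit.QuantumFields.QCD.Cruxes.QuarkLoopCoefficient.Sketch

end
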